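import Literature.Probability.RandomPlanarGeometry.SLEKappaRhoRestriction
import Literature.Probability.RandomPlanarGeometry.LoewnerHullCapacity
import HarnessLib

/-!
# [LSW] Theorem 8.4, the avoidance formula: Lemma 8.3 (4) and the closure statement proved from the other leaves

Proof-only complement to `SLEKappaRhoRestriction` (the decomposition of the named fact
`Literature.Probability.RandomPlanarGeometry.SLEKappaRho.measure_fill_disjoint`, [LSW] Thm. 8.4 in
avoidance form, into its printed leaves), after

* G. F. Lawler, O. Schramm, W. Werner, *Conformal restriction: the chordal case*, J. Amer. Math.
  Soc. **16** (2003) 917–955, arXiv:math/0209343 (**[LSW]**), Lemma 8.3 (4) (p. 36): "`K_∞` is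
  a.s. unbounded", with its printed proof "Statement 4 easily follows from 1, for example. One
  could also use the fact that the half-plane capacity of `K_t` is `2t`."

The second printed argument is now available in the tree: `hcap(K_t) = 2t` for the Loewner
chain of every continuous driving function, whence `⋃_t K_t` is unbounded
(`Loewner.not_isBounded_iUnion_hull`, `LoewnerHullCapacity`), and the paths of the SLE(κ, ρ)
driving process are a.s. continuous given the integrated Bessel equation
(`IsSLEKappaRhoPair.ae_continuous` from `SLEKappaRho.integral_inv_eq`, `SLEKappaRhoRestriction`).
Hence:

* `SLEKappaRho.not_isBounded_hullUnion_of_integral_inv_eq` — the named fact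
  `SLEKappaRho.not_isBounded_hullUnion` ([LSW] Lemma 8.3 (4)) follows from
  `SLEKappaRho.integral_inv_eq`.

Then the closure statement — the last paragraph of the proof of Thm. 8.4 (§8.4): "It remains to
prove that a.s. `K̄_∞ ∩ A = ∅` iff `K_∞ ∩ A = ∅`. As `K_t` is closed for each `t`, the proof of
this fact is essentially identical to the argument showing that `⋂_{s>0} Ξ̄_s = ∅` given at the
end of the proof of Theorem 7.3" — a step of the parent's proof rather than a separate published
result, which the assembly `SLEKappaRho.measure_fill_disjoint_of_leaves` (`SLEKappaRhoRestriction`)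
takes as its closure hypothesis `hcl` — is PROVED from the other five leaves, by the probability
estimate of the argument referred to (§7.2: an avoidance probability `Φ'(…)^α` close to `1`) run
with [LSW]'s outer hulls `E_δ = cl(A ∪ Φ_A⁻¹(D_δ))` of the proof of Lemma 3.5 / Lemma 2.1
(`IsSlitHull.arcHull`, `ArcApproximation`, `SmoothArcApproximation`) in place of the Markov
property of the driving pair (not in the tree):

* `IsSlitHull.exists_forall_mem_arcHull` — `E_δ` contains a uniform `ℍ̄`-neighbourhood of `A`
  (uniform cluster lemma + Lebesgue number);
* `SLEKappaRho.ae_disjoint_closure_of_hullHitTime_eq_top` — a.s. on `{T_A = ∞}`,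
  `cl K_∞ ∩ A = ∅`: a point of `cl K_∞ ∩ A` forces `T_{E_δ} < ∞`, and
  `P[T_A = ∞] − P[T_{E_δ} = ∞] = Φ_A'(0)^α − Φ'_{E_δ}(0)^α → 0` as `δ ↓ 0`
  (`SLEKappaRho.measure_hullHitTime_eq_top` twice, `IsSlitHull.tendsto_restrictionDeriv_arcHull`);
* `SLEKappaRho.ae_disjoint_closure_iff_of_leaves` — the printed sentence, a.s.
  `cl K_∞ ∩ A = ∅ ↔ K_∞ ∩ A = ∅` for every SLE(8/3, ρ) driving pair and every smooth `A ∈ 𝒬₊`,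
  from FIVE leaves (`SLEKappaRho.integral_inv_eq`, `SLEKappaRho.exists_isOneSidedMartingale`,
  `Loewner.restrictionDeriv_exitTime_gt`, `IsSmoothHull.restrictionDerivVanishesAtHit`,
  `SLEKappaRho.swallowingTime_ofReal`), hence `SLEKappaRho.measure_fill_disjoint_of_five_leaves`
  and `SLEKappaRho.isRightRestrictionMeasure_fill_of_five_leaves`: Thm. 8.4 rests on these five
  named facts (plus `SLEKappaRho.exists_measurable_fill_version` for the law form).
-/

noncomputable section

open MeasureTheory Filter
open scoped NNReal

namespace Literature.Probability.RandomPlanarGeometry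

/-- **[LSW] Lemma 8.3 (4) (`K_∞` is a.s. unbounded) from the integrated Bessel equation**: the
paths of `W` are a.s. continuous (`IsSLEKappaRhoPair.ae_continuous`, from
`SLEKappaRho.integral_inv_eq`), and the union of the hulls of the Loewner chain of a continuous
driving function is unbounded (`Loewner.not_isBounded_iUnion_hull`: `hcap(K_t) = 2t` — the
alternative proof indicated in print, "One could also use the fact that the half-plane capacity
of `K_t` is `2t`"). This discharges the named fact `SLEKappaRho.not_isBounded_hullUnion`
conditionally on `SLEKappaRho.integral_inv_eq`.
[cite: LawlerSchrammWerner2003Restriction, Lemma 8.3 (4) and its proof (p. 36)] -/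
theorem SLEKappaRho.not_isBounded_hullUnion_of_integral_inv_eq (hint : SLEKappaRho.integral_inv_eq) :
    SLEKappaRho.not_isBounded_hullUnion := by
  intro κ ρ O W hκ hρ hOW
  filter_upwards [hOW.ae_continuous hint hκ hρ] with ω hω
  exact Loewner.not_isBounded_iUnion_hull hω.1


/-! ### The last paragraph of the proof of Thm. 8.4: `cl K_∞ ∩ A = ∅` iff `K_∞ ∩ A = ∅`, from the five leaves -/

section Closure

open Set Metric
open _root_.UpperHalfPlane (upperHalfPlaneSet)
open _root_.Literature.Probability.Process (preWienerMeasure)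
open scoped _root_.Topology _root_.ENNReal

namespace IsSlitHull

variable {A : Set ℂ} {p q : ℝ} (h : IsSlitHull A p q)
include h

/-- **`E_δ` contains a uniform `ℍ̄`-neighbourhood of `A`**: for `δ > 0` there is `η > 0` such
that every point of the closed half-plane within distance `η` of `A` lies in [LSW]'s hull
`E_δ = cl(A ∪ Φ_A⁻¹(D_δ))` (`IsSlitHull.arcHull`; the uniform cluster lemma
`exists_forall_infDist_ext_lt` at each point of the compact set `A`, a Lebesgue number of the
resulting cover of `A`, and `E_δ` is closed). [folklore] -/
theorem exists_forall_mem_arcHull {δ : ℝ} (hδ : 0 < δ) :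
    ∃ η > 0, ∀ z : ℂ, 0 ≤ z.im → infDist z A < η → z ∈ h.arcHull δ := by
  have hAc : IsCompact A := h.isStarHull.isBoundedHull.isCompact
  have hr : ∀ a : A, ∃ r > 0, ∀ z ∈ upperHalfPlaneSet \ A, dist z a < r →
      infDist (h.ext z) (realSeg h.lower h.upper) < δ := fun a ↦
    h.exists_forall_infDist_ext_lt (fun haΩ ↦ haΩ (Or.inl (Or.inl a.2))) hδ
  choose r hr0 hrδ using hr
  obtain ⟨η, hη0, hη⟩ := lebesgue_number_lemma_of_metric (c := fun a : A ↦ ball (a : ℂ) (r a))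
    hAc (fun _ ↦ isOpen_ball) fun a ha ↦ mem_iUnion.2 ⟨⟨a, ha⟩, mem_ball_self (hr0 ⟨a, ha⟩)⟩
  refine ⟨η, hη0, fun z hzim hzA ↦ ?_⟩
  obtain ⟨a, haA, hza⟩ := (infDist_lt_iff h.nonempty).1 hzA
  obtain ⟨b, hb⟩ := hη a haA
  have hzb : z ∈ ball (b : ℂ) (r b) := hb (mem_ball.2 hza)
  -- `B(b, r_b) ∩ ℍ ⊆ E_δ`, and `z` lies in the closure of that set
  have hsub : ball (b : ℂ) (r b) ∩ upperHalfPlaneSet ⊆ h.arcHull δ := by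
    rintro w ⟨hwb, hwH⟩
    by_cases hwA : w ∈ A
    · exact h.subset_arcHull hwA
    · exact h.mem_arcHull_of_mem_core ⟨hwH, hwA⟩
        ⟨(h.mapsTo_ext ⟨hwH, hwA⟩).le, (hrδ b w ⟨hwH, hwA⟩ (mem_ball.1 hwb)).le⟩
  have hzcl : z ∈ closure (ball (b : ℂ) (r b) ∩ upperHalfPlaneSet) :=
    isOpen_ball.inter_closure ⟨hzb, mem_closure_upperHalfPlaneSet_iff.2 hzim⟩
  exact closure_minimal hsub h.isClosed_arcHull hzcl

end IsSlitHull

variable {ρ : ℝ} {O W : ℝ≥0 → (ℝ≥0 → ℝ) → ℝ} {A : Set ℂ}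

/-- **A.s. on `{T_A = ∞}` the hulls do not accumulate on `A`: `cl K_∞ ∩ A = ∅`**, for a smooth
hull `A ∈ 𝒬₊` along SLE(8/3, ρ), from the five leaves of Thm. 8.4. This is the content of the
last paragraph of the proof of [LSW] Thm. 8.4 ("It remains to prove that a.s. `K̄_∞ ∩ A = ∅` iff
`K_∞ ∩ A = ∅`. As `K_t` is closed for each `t`, the proof of this fact is essentially identical
to the argument showing that `⋂_{s>0} Ξ̄_s = ∅` given at the end of the proof of Theorem 7.3"),
proved here by the probability estimate of that argument (§7.2: a conditional avoidance
probability `Φ'(…)^α → 1`) run with [LSW]'s outer hulls `E_δ = cl(A ∪ Φ_A⁻¹(D_δ))` of the proof of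
Lemma 3.5 / Lemma 2.1 (`IsSlitHull.arcHull`) instead of the Markov property: `E_δ` is a smooth
hull of `𝒬₊` containing a uniform `ℍ̄`-neighbourhood of `A` (`IsSlitHull.exists_forall_mem_arcHull`),
so a point of `cl K_∞ ∩ A` forces `T_{E_δ} < ∞`; hence
`P[T_A = ∞, cl K_∞ ∩ A ≠ ∅] ≤ P[T_A = ∞] − P[T_{E_δ} = ∞] = Φ_A'(0)^α − Φ'_{E_δ}(0)^α`
(`SLEKappaRho.measure_hullHitTime_eq_top`, twice), which tends to `0` as `δ ↓ 0`
(`IsSlitHull.tendsto_restrictionDeriv_arcHull`).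
[cite: LawlerSchrammWerner2003Restriction, proof of Thm. 8.4, last paragraph (§8.4), with the end of the proof of Thm. 7.3 (§7.2)] -/
theorem SLEKappaRho.ae_disjoint_closure_of_hullHitTime_eq_top
    [Fact Process.isProjectiveLimit_preWienerMeasure]
    (hint : SLEKappaRho.integral_inv_eq) (hM : SLEKappaRho.exists_isOneSidedMartingale)
    (h62 : Loewner.restrictionDeriv_exitTime_gt) (h63 : IsSmoothHull.restrictionDerivVanishesAtHit)
    (h83 : SLEKappaRho.swallowingTime_ofReal)
    (hρ : -2 < ρ) (hOW : IsSLEKappaRhoPair (8 / 3) ρ O W) (hAs : IsSmoothHull A) (hA : IsPlusHull A) :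
    ∀ᵐ ω ∂preWienerMeasure, Loewner.hullHitTime (fun s ↦ W s ω) A = ⊤ →
      Disjoint (closure (⋃ t, Loewner.closedHull (fun s ↦ W s ω) t)) A := by
  rcases A.eq_empty_or_nonempty with rfl | hne
  · exact Eventually.of_forall fun ω _ ↦ Set.disjoint_empty _
  have h84 : SLEKappaRho.not_isBounded_hullUnion :=
    SLEKappaRho.not_isBounded_hullUnion_of_integral_inv_eq hint
  -- [LSW]'s hulls `E_δ` around `A` (proof of Lemma 3.5 / Lemma 2.1): smooth hulls of `𝒬₊`
  have h := hA.isSlitHull hne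
  have h0 : 0 < min (sInf (realTrace A) / 2) (sSup (realTrace A)) := by
    have hT : IsCompact (realTrace A) := isCompact_realTrace hA.1.isBoundedHull.isCompact
    have hTne : (realTrace A).Nonempty := hA.1.isBoundedHull.realTrace_nonempty hne
    have hm : sInf (realTrace A) ∈ realTrace A := hT.sInf_mem hTne
    have hm0 : 0 < sInf (realTrace A) := hA.2 _ hm
    have hmM : sInf (realTrace A) ≤ sSup (realTrace A) := le_csSup hT.bddAbove hm
    exact lt_min (by linarith) (by linarith)
  set J : ℕ → Set ℂ := fun n ↦ h.arcHull (h.deltaSeq n) with hJ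
  have hJs : ∀ n, IsSmoothHull (J n) := fun n ↦
    h.isSmoothHull_arcHull (h.deltaSeq_pos h0 n) (h.two_mul_deltaSeq_lt h0 n)
  have hJp : ∀ n, IsPlusHull (J n) := fun n ↦
    h.isPlusHull_arcHull h0 (h.deltaSeq_pos h0 n) (h.two_mul_deltaSeq_lt h0 n)
  -- restriction data of `A` and of the `J n`; `Φ'_{J n}(0) → Φ'_A(0)`
  obtain ⟨Φ, hΦ, -⟩ := IsStarHull.existsUnique_isRestrictionMap_holds hA.1
  obtain ⟨d, -, -, hd⟩ := IsStarHull.exists_hasRestrictionDeriv_holds hA.1 hΦ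
  have hdata : ∀ n, ∃ (Ψ : ConformalEquiv (upperHalfPlaneSet \ J n) upperHalfPlaneSet) (e : ℝ),
      IsRestrictionMap (J n) Ψ ∧ HasRestrictionDeriv (J n) Ψ e := fun n ↦ by
    obtain ⟨Ψ, hΨ, -⟩ := IsStarHull.existsUnique_isRestrictionMap_holds (hJp n).1
    obtain ⟨e, -, -, he⟩ := IsStarHull.exists_hasRestrictionDeriv_holds (hJp n).1 hΨ
    exact ⟨Ψ, e, hΨ, he⟩
  choose Ψ dn hΨ hdn using hdata
  have hlim : Tendsto dn atTop (𝓝 d) := h.tendsto_restrictionDeriv_arcHull h0 hΦ hΨ hd hdn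
  -- the events `{T_{J n} = ∞} ⊆ {T_A = ∞}` and their probabilities
  set E : Set (ℝ≥0 → ℝ) := {ω | Loewner.hullHitTime (fun s ↦ W s ω) A = ⊤} with hE
  set En : ℕ → Set (ℝ≥0 → ℝ) := fun n ↦
    {ω | Loewner.hullHitTime (fun s ↦ W s ω) (J n) = ⊤} with hEn
  have hPE : preWienerMeasure E = ENNReal.ofReal (d ^ sleKappaRhoExponent ρ) :=
    (SLEKappaRho.measure_hullHitTime_eq_top hint hM h62 h63 h83 h84 hρ hOW hAs hA hΦ hd).2
  have hPEn : ∀ n, NullMeasurableSet (En n) preWienerMeasure ∧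
      preWienerMeasure (En n) = ENNReal.ofReal (dn n ^ sleKappaRhoExponent ρ) := fun n ↦
    SLEKappaRho.measure_hullHitTime_eq_top hint hM h62 h63 h83 h84 hρ hOW (hJs n) (hJp n) (hΨ n)
      (hdn n)
  have hEnE : ∀ n, En n ⊆ E := by
    intro n ω hω
    have hω' : Loewner.hullHitTime (fun s ↦ W s ω) (J n) = ⊤ := hω
    show Loewner.hullHitTime (fun s ↦ W s ω) A = ⊤
    rw [Loewner.hullHitTime_eq_top_iff] at hω' ⊢
    exact fun t ↦ (hω' t).mono_right h.subset_arcHull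
  -- the bad event lies in `{T_A = ∞} ∖ {T_{J n} = ∞}` for every `n`
  set B : Set (ℝ≥0 → ℝ) := {ω | Loewner.hullHitTime (fun s ↦ W s ω) A = ⊤ ∧
    ¬ Disjoint (closure (⋃ t, Loewner.closedHull (fun s ↦ W s ω) t)) A} with hB
  have hBsub : ∀ n, B ⊆ E \ En n := by
    rintro n ω ⟨hT, hcl⟩
    refine ⟨hT, fun hTn ↦ hcl ?_⟩
    have hTn' : Loewner.hullHitTime (fun s ↦ W s ω) (J n) = ⊤ := hTn
    obtain ⟨η, hη, hηJ⟩ := h.exists_forall_mem_arcHull (h.deltaSeq_pos h0 n)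
    refine Set.disjoint_left.2 fun z hzcl hzA ↦ ?_
    obtain ⟨w, hw, hzw⟩ := Metric.mem_closure_iff.1 hzcl η hη
    obtain ⟨t, hwt⟩ := mem_iUnion.1 hw
    have hwJ : w ∈ J n :=
      hηJ w hwt.1 ((infDist_le_dist_of_mem hzA).trans_lt (by rwa [dist_comm]))
    exact Set.disjoint_left.1 (Loewner.hullHitTime_eq_top_iff.1 hTn' t) hwt hwJ
  -- hence it is null: `P[B] ≤ Φ_A'(0)^α − Φ'_{J n}(0)^α → 0`
  have hPB : preWienerMeasure B = 0 := by
    refine le_antisymm ?_ bot_le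
    have h3 : Tendsto (fun n ↦ ENNReal.ofReal (dn n ^ sleKappaRhoExponent ρ)) atTop
        (𝓝 (ENNReal.ofReal (d ^ sleKappaRhoExponent ρ))) :=
      ENNReal.tendsto_ofReal (hlim.rpow_const (Or.inr (sleKappaRhoExponent_pos hρ).le))
    have htend : Tendsto (fun n ↦ ENNReal.ofReal (d ^ sleKappaRhoExponent ρ) -
        ENNReal.ofReal (dn n ^ sleKappaRhoExponent ρ)) atTop (𝓝 0) := by
      have h4 := ((ENNReal.continuous_sub_left
        (ENNReal.ofReal_ne_top (r := d ^ sleKappaRhoExponent ρ))).tendsto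
        (ENNReal.ofReal (d ^ sleKappaRhoExponent ρ))).comp h3
      rw [tsub_self] at h4
      exact h4
    refine ge_of_tendsto' htend fun n ↦ ?_
    calc preWienerMeasure B ≤ preWienerMeasure (E \ En n) := measure_mono (hBsub n)
      _ = preWienerMeasure E - preWienerMeasure (En n) :=
          measure_sdiff (hEnE n) (hPEn n).1 (measure_ne_top _ _)
      _ = ENNReal.ofReal (d ^ sleKappaRhoExponent ρ) -
            ENNReal.ofReal (dn n ^ sleKappaRhoExponent ρ) := by rw [hPE, (hPEn n).2]
  rw [measure_eq_zero_iff_ae_notMem] at hPB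
  filter_upwards [hPB] with ω hω hT
  by_contra hcl
  exact hω ⟨hT, hcl⟩

/-- **The last paragraph of the proof of [LSW] Thm. 8.4, from the five remaining leaves of
Thm. 8.4** (§8.4, verbatim: "It remains to prove that a.s. `K̄_∞ ∩ A = ∅` iff `K_∞ ∩ A = ∅`. As
`K_t` is closed for each `t`, the proof of this fact is essentially identical to the argument
showing that `⋂_{s>0} Ξ̄_s = ∅` given at the end of the proof of Theorem 7.3"; here
`K_∞ = ⋃_{t ≥ 0} K_t` for the hulls `K_t ⊆ ℍ̄` of SLE(8/3, ρ) in the closed half-plane,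
`Loewner.closedHull` of the driving function `t ↦ W_t(ω)`, and `A` is the smooth hull of `𝒬₊`
fixed in §8.4) — given the integrated Bessel equation of §8.3 (`SLEKappaRho.integral_inv_eq`),
Lemmas 8.9/8.10 (`SLEKappaRho.exists_isOneSidedMartingale`), Lemma 6.2
(`Loewner.restrictionDeriv_exitTime_gt`), Lemma 6.3 (`IsSmoothHull.restrictionDerivVanishesAtHit`)
and Lemma 8.3 (2)–(3) (`SLEKappaRho.swallowingTime_ofReal`): for `ρ > −2`, every SLE(8/3, ρ)
driving pair `(O, W)` and every smooth `A ∈ 𝒬₊`, a.s. `cl K_∞ ∩ A = ∅ ↔ K_∞ ∩ A = ∅`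
(`K_∞ ∩ A = ∅` is `T_A = ∞`, and on that event `cl K_∞ ∩ A = ∅` a.s. by
`SLEKappaRho.ae_disjoint_closure_of_hullHitTime_eq_top`). This is the closure hypothesis `hcl` of
the assembly `SLEKappaRho.measure_fill_disjoint_of_leaves` (`SLEKappaRhoRestriction`), so Thm. 8.4
rests on the five leaves (`SLEKappaRho.measure_fill_disjoint_of_five_leaves`).
[cite: LawlerSchrammWerner2003Restriction, proof of Thm. 8.4, last paragraph (§8.4)] -/
theorem SLEKappaRho.ae_disjoint_closure_iff_of_leaves
    (hint : SLEKappaRho.integral_inv_eq) (hM : SLEKappaRho.exists_isOneSidedMartingale)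
    (h62 : Loewner.restrictionDeriv_exitTime_gt) (h63 : IsSmoothHull.restrictionDerivVanishesAtHit)
    (h83 : SLEKappaRho.swallowingTime_ofReal) :
    ∀ {ρ : ℝ} {O W : ℝ≥0 → (ℝ≥0 → ℝ) → ℝ}, -2 < ρ → IsSLEKappaRhoPair (8 / 3) ρ O W →
      ∀ {A : Set ℂ}, IsSmoothHull A → IsPlusHull A →
        ∀ᵐ ω ∂preWienerMeasure,
          Disjoint (closure (⋃ t, Loewner.closedHull (fun s ↦ W s ω) t)) A ↔
            Disjoint (⋃ t, Loewner.closedHull (fun s ↦ W s ω) t) A := by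
  haveI : Fact Process.isProjectiveLimit_preWienerMeasure := ⟨isProjectiveLimit_preWienerMeasure_holds⟩
  intro ρ O W hρ hOW A hAs hA
  filter_upwards [SLEKappaRho.ae_disjoint_closure_of_hullHitTime_eq_top hint hM h62 h63 h83 hρ hOW
    hAs hA] with ω hω
  refine ⟨fun hcl ↦ hcl.mono_left subset_closure, fun hK ↦ hω ?_⟩
  rw [Loewner.hullHitTime_eq_top_iff]
  exact fun t ↦ hK.mono_left (subset_iUnion _ t)

/-- **`SLEKappaRho.measure_fill_disjoint` ([LSW] Thm. 8.4 in avoidance form) from FIVE named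
facts** — the integrated Bessel equation of §8.3 (`SLEKappaRho.integral_inv_eq`), Lemmas 8.9/8.10
(`SLEKappaRho.exists_isOneSidedMartingale`), Lemma 6.2 (`Loewner.restrictionDeriv_exitTime_gt`),
Lemma 6.3 (`IsSmoothHull.restrictionDerivVanishesAtHit`) and Lemma 8.3 (2)–(3)
(`SLEKappaRho.swallowingTime_ofReal`): as `SLEKappaRho.measure_fill_disjoint_of_leaves`
(`SLEKappaRhoRestriction`), with its closure hypothesis (the last paragraph of the proof of
Thm. 8.4) supplied by `SLEKappaRho.ae_disjoint_closure_iff_of_leaves` and [LSW] Lemma 8.3 (4) by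
`SLEKappaRho.not_isBounded_hullUnion_of_integral_inv_eq`.
[cite: LawlerSchrammWerner2003Restriction, Thm. 8.4 (p. 37) and its proof (§8.4)] -/
theorem SLEKappaRho.measure_fill_disjoint_of_five_leaves
    (hint : SLEKappaRho.integral_inv_eq) (hM : SLEKappaRho.exists_isOneSidedMartingale)
    (h62 : Loewner.restrictionDeriv_exitTime_gt) (h63 : IsSmoothHull.restrictionDerivVanishesAtHit)
    (h83 : SLEKappaRho.swallowingTime_ofReal) : SLEKappaRho.measure_fill_disjoint :=
  SLEKappaRho.measure_fill_disjoint_of_leaves hint hM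
    (SLEKappaRho.ae_disjoint_closure_iff_of_leaves hint hM h62 h63 h83) h62 h63 h83
    (SLEKappaRho.not_isBounded_hullUnion_of_integral_inv_eq hint)

/-- **[LSW] Thm. 8.4 in law form from the five leaves and the measurable version**: the law of an
`Ω₊`-valued version of `K = F^{ℝ₊}_ℍ(cl K_∞)` is `P⁺_{α(ρ)}`
(`SLEKappaRho.isRightRestrictionMeasure_fill`), by `SLEKappaRho.isRightRestrictionMeasure_fill_of`
(`SLEKappaRho`) and `SLEKappaRho.measure_fill_disjoint_of_five_leaves`.
[cite: LawlerSchrammWerner2003Restriction, Thm. 8.4 (p. 37) with §8.1 (p. 31)] -/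
theorem SLEKappaRho.isRightRestrictionMeasure_fill_of_five_leaves
    (h₁ : SLEKappaRho.exists_measurable_fill_version)
    (hint : SLEKappaRho.integral_inv_eq) (hM : SLEKappaRho.exists_isOneSidedMartingale)
    (h62 : Loewner.restrictionDeriv_exitTime_gt) (h63 : IsSmoothHull.restrictionDerivVanishesAtHit)
    (h83 : SLEKappaRho.swallowingTime_ofReal) : SLEKappaRho.isRightRestrictionMeasure_fill :=
  SLEKappaRho.isRightRestrictionMeasure_fill_of h₁
    (SLEKappaRho.measure_fill_disjoint_of_five_leaves hint hM h62 h63 h83)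

end Closure

end Literature.Probability.RandomPlanarGeometry

end
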